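import Summits.SmoothPoincare4.SmoothPoincare4.Theorems.CongruenceShadowsShadowApproximationStubLayerStepZeroTwoCalculus
import Summits.SmoothPoincare4.SmoothPoincare4.Theorems.CongruenceShadowsShadowApproximationStubLayerStepZeroOne
import HarnessLib

/-!
# Helper `helper_layerZeroThreeCore` (the layer step from a Lie-realising family, every level) for stub
`stub_layerStepZeroThree` of line `nilpotent-genus-class`, crux `CongruenceShadows.ShadowApproximation`
(item stmt-SmoothPoincare4-14595)

Genus `3`, notation of the siblings: `S = S₃`, `Nᵢ = s4Kernels i` (`N₂ = ⟪b₀, a₁, a₂⟫`), `γₖ₊₁ = (⊤).lowerCentralSeries k`,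
`𝒥ₖ = {ψ ∈ Aut S | ψ(s)s⁻¹ ∈ γₖ₊₁}`, `θₖ` the Magnus–Witt symbols of `F₃` and `π : S ↠ F₃` the erasing projection of `N₂`
(cut letters `X_j = b₀, a₁, a₂ ↦ 1`, mates `a₀, b₁, b₂ ↦ y₀, y₁, y₂`).  Both `θ` and `π` are VARIABLES here, carried with
their characterising hypotheses exactly as `stub_freeGroupGrLie 3` and `helper_glueErasePi 0 2` deliver them, so that a
user first obtains `θ, π`, then tabulates the data of its realisers with respect to the same `θ, π`.

* `layerStep_core_of_family` — THE LAYER STEP `(0, c)` FROM A LIE-REALISING FAMILY, uniformly in the level `c`: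
  given (AUTSYMP) at genus `3`, (REAL) for the pair `(0,1)`, and ANY finite family `U₁, …, Uₙ ∈ Stab N₀ ∩ Stab N₁ ∩ 𝒥_{c+1}`
  whose degree-`(c+2)` data `θ_{c+1}(π(U_k(X_j)X_j⁻¹))` realise (as an integer combination) the negative of every
  relator-constrained datum `D ∈ L_{c+2}(ℤ³)³` (`⁅y₀, D₀⁆ + ⁅D₁, y₁⁆ + ⁅D₂, y₂⁆ = 0`), every `K₂ = α(N₂)`, `α ∈ Stab N₀`,
  with `K₂ γ_{c+2} = N₂ γ_{c+2}` is reached modulo `γ_{c+3}` by some `y ∈ Stab N₀ ∩ Stab N₁`.  This is the proof of the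
  landed `(0,1)` / `(0,2)` cores (`layerStepZeroOne_core`, `layerStepZeroTwo_core`) with the realisers abstracted:
  pair normalisation, honest datum and constraint in the free group `S ⧸ K₂`, `y = ∏ U_k ^ e_k` (data add on `𝒥_{c+1}`),
  torsor calculus `helper_layerOfData` with the transfer one level up;
* `datum_list_prod_zpow_level`, `mem_commutator_sup_of_map_mem_level` — data add on `𝒥ₖ` and the transfer, every level;
* `helper_layerZeroThreeCore` — the registered closed form at `c = 3` (data in `𝒥₄`, degree `5`, `γ₅ → γ₆`).
No definitions, no notations.
-/

set_option linter.dupNamespace false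

noncomputable section

open Subgroup Literature.Topology.FourManifolds Literature.Algebra.Lie Multiplicative
open Summit.SmoothPoincare4.SmoothPoincare4.Theorems.NilpotentShadowsStandard.SaturatedTorsorDescent
open scoped commutatorElement

namespace Summit.SmoothPoincare4.SmoothPoincare4.Theorems.ShadowApproximation.NilpotentGenusClass

namespace LayerZeroThree

open LayerZeroOne LayerZeroTwo

/-! ## Generalities at every level -/

/-- Transfer one level up, every level: an element of `γₖ₊₂` whose image under a surjection `π` onto a free group
lies in `γₖ₊₃` lies in `[ker π, G] γₖ₊₃`, provided `ker π` has no hidden depth. [folklore] -/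
theorem mem_commutator_sup_of_map_mem_level {G M : Type*} [Group G] [Group M] (π : G →* M)
    (hπ : Function.Surjective π)
    (hker : π.ker ⊓ (⊤ : Subgroup G).lowerCentralSeries 1 ≤ ⁅π.ker, (⊤ : Subgroup G)⁆) (k : ℕ)
    {w : G} (hw : w ∈ (⊤ : Subgroup G).lowerCentralSeries (k + 1))
    (h : π w ∈ (⊤ : Subgroup M).lowerCentralSeries (k + 1 + 1)) :
    w ∈ ⁅π.ker, (⊤ : Subgroup G)⁆ ⊔ (⊤ : Subgroup G).lowerCentralSeries (k + 2) := by
  rw [← map_lcs_eq_of_surjective π hπ (k + 1 + 1)] at h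
  obtain ⟨z, hz, hzw⟩ := h
  have h1 : w * z⁻¹ ∈ π.ker := by
    rw [MonoidHom.mem_ker, map_mul, map_inv, hzw, mul_inv_cancel]
  have h2 : w * z⁻¹ ∈ π.ker ⊓ (⊤ : Subgroup G).lowerCentralSeries 1 :=
    mem_inf.2 ⟨h1, mul_mem (lcs_antitone (by omega) hw) (inv_mem (lcs_antitone (by omega) hz))⟩
  have e : w = (w * z⁻¹) * z := by rw [inv_mul_cancel_right]
  rw [e]
  exact mul_mem (mem_sup_left (hker h2)) (mem_sup_right hz)

section Symbols

variable (θ : ℕ → FreeGroup (Fin 3) → FreeLieAlgebra ℤ (Fin 3))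
  (hadd : ∀ k, ∀ x ∈ (⊤ : Subgroup (FreeGroup (Fin 3))).lowerCentralSeries k,
    ∀ y ∈ (⊤ : Subgroup (FreeGroup (Fin 3))).lowerCentralSeries k, θ k (x * y) = θ k x + θ k y)
  (himg : ∀ k, θ k '' ((⊤ : Subgroup (FreeGroup (Fin 3))).lowerCentralSeries k) =
    wordGrade ℤ (FreeLieAlgebra.of ℤ : Fin 3 → FreeLieAlgebra ℤ (Fin 3)) (k + 1))
  (hker : ∀ k, ∀ x ∈ (⊤ : Subgroup (FreeGroup (Fin 3))).lowerCentralSeries k,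
    θ k x = 0 ↔ x ∈ (⊤ : Subgroup (FreeGroup (Fin 3))).lowerCentralSeries (k + 1))
  (hof : ∀ i : Fin 3, θ 0 (FreeGroup.of i) = FreeLieAlgebra.of ℤ i)
  (hbr : ∀ j k, ∀ x ∈ (⊤ : Subgroup (FreeGroup (Fin 3))).lowerCentralSeries j,
    ∀ y ∈ (⊤ : Subgroup (FreeGroup (Fin 3))).lowerCentralSeries k, θ (j + k + 1) ⁅x, y⁆ = ⁅θ j x, θ k y⁆)
  (π : SurfaceGroup 3 →* FreeGroup (Fin 3))

include hadd hker in
/-- **Data add on `𝒥ₖ`** (`1 ≤ k`): the product `y = ∏ Ψᵢ ^ nᵢ` (in `Aut S₃`) of elements of `𝒥ₖ` lies in `𝒥ₖ` and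
`θₖ(π(y(s)s⁻¹)) = ∑ nᵢ θₖ(π(Ψᵢ(s)s⁻¹))`. [folklore] -/
theorem datum_list_prod_zpow_level (k : ℕ) (hk : 1 ≤ k) {ι : Type*} (l : List ι)
    (Ψ : ι → SurfaceGroup 3 ≃* SurfaceGroup 3) (n : ι → ℤ)
    (hΨ : ∀ i, ∀ s, Ψ i s * s⁻¹ ∈ (⊤ : Subgroup (SurfaceGroup 3)).lowerCentralSeries k) (s : SurfaceGroup 3) :
    (∀ s, (l.map fun i => ((Ψ i : MulAut (SurfaceGroup 3)) ^ n i : MulAut (SurfaceGroup 3))).prod s * s⁻¹ ∈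
      (⊤ : Subgroup (SurfaceGroup 3)).lowerCentralSeries k) ∧
    θ k (π ((l.map fun i => ((Ψ i : MulAut (SurfaceGroup 3)) ^ n i : MulAut (SurfaceGroup 3))).prod s * s⁻¹)) =
      (l.map fun i => n i • θ k (π (Ψ i s * s⁻¹))).sum := by
  obtain ⟨h1, h2⟩ := jk_list_prod_zpow (k := k) hk l Ψ n hΨ
  refine ⟨h1, ?_⟩
  have hmem : ∀ l' : List ι, (l'.map fun i => (Ψ i s * s⁻¹) ^ n i).prod ∈
      (⊤ : Subgroup (SurfaceGroup 3)).lowerCentralSeries k := fun l' =>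
    list_prod_mem fun x hx => by
      obtain ⟨i, -, rfl⟩ := List.mem_map.1 hx
      exact zpow_mem (hΨ i s) _
  have h3 : (((l.map fun i => ((Ψ i : MulAut (SurfaceGroup 3)) ^ n i : MulAut (SurfaceGroup 3))).prod s * s⁻¹ :
      SurfaceGroup 3) : SurfaceGroup 3 ⧸ (⊤ : Subgroup (SurfaceGroup 3)).lowerCentralSeries (k + 1)) =
      (((l.map fun i => (Ψ i s * s⁻¹) ^ n i).prod : SurfaceGroup 3) : SurfaceGroup 3 ⧸ _) := by
    rw [h2 s, ← QuotientGroup.mk'_apply, map_list_prod, List.map_map]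
    refine congrArg List.prod (List.map_congr_left fun i _ => ?_)
    rw [Function.comp_apply, map_zpow, QuotientGroup.mk'_apply]
  have key : ∀ l' : List ι, θ k (π ((l'.map fun i => (Ψ i s * s⁻¹) ^ n i).prod)) =
      (l'.map fun i => n i • θ k (π (Ψ i s * s⁻¹))).sum := by
    intro l'
    induction l' with
    | nil => simp only [List.map_nil, List.prod_nil, List.sum_nil, map_one]; exact theta_one θ hadd k
    | cons i l' ih =>
      rw [List.map_cons, List.prod_cons, List.map_cons, List.sum_cons, map_mul,
        hadd k _ (FreeGroupGrLie.map_mem_lcs π (zpow_mem (hΨ i s) _)) _ (FreeGroupGrLie.map_mem_lcs π (hmem l')), ih,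
        map_zpow, theta_zpow θ hadd k (FreeGroupGrLie.map_mem_lcs π (hΨ i s))]
  rw [theta_pi_congr θ hadd hker π k (hmem l) h3, key]

variable (hπs : Function.Surjective π) (hπker : π.ker = s4Kernels 2)
  (hπof : ∀ (h : Fin 3) (b : Bool), π (PresentedGroup.of (h, b)) =
    if b = (![true, false, false] : Fin 3 → Bool) h then 1 else FreeGroup.of h)

include hadd himg hker hof hbr hπs hπker hπof in
/-- **The layer step `(0, c)` at genus 3 from a Lie-realising family, core form (every level `c`).** Given (AUTSYMP)
at genus `3`, (REAL) for the pair `(0,1)` and a finite family `U₁, …, Uₙ ∈ Stab N₀ ∩ Stab N₁ ∩ 𝒥_{c+1}` whose degree-`(c+2)`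
data at the cut letters `b₀, a₁, a₂` of `N₂` realise the negative of every relator-constrained datum of `L_{c+2}(ℤ³)³`,
a subgroup `K₂ = α(N₂)` with `α ∈ Stab N₀` and `K₂ γ_{c+2} = N₂ γ_{c+2}` is reached modulo `γ_{c+3}` by a Goeritz
element: some `y ∈ Stab N₀ ∩ Stab N₁` has `y(N₂ γ_{c+3}) = K₂ γ_{c+3}`. [folklore] -/
theorem layerStep_core_of_family (c : ℕ)
    (hA : ∀ (φ : SurfaceGroup 3 ≃* SurfaceGroup 3),
      ∃ (F : (surfaceGen 3 → ℤ) ≃ₗ[ℤ] (surfaceGen 3 → ℤ)) (ε : ℤ), (ε = 1 ∨ ε = -1) ∧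
        (∀ s : SurfaceGroup 3, toAdd (SurfaceGroup.abelianize 3 (φ s)) = F (toAdd (SurfaceGroup.abelianize 3 s))) ∧
        ∀ u v : surfaceGen 3 → ℤ, symplForm (F u) (F v) = ε * symplForm u v)
    (hR : ∀ (F : (surfaceGen 3 → ℤ) ≃ₗ[ℤ] (surfaceGen 3 → ℤ)) (ε : ℤ), (ε = 1 ∨ ε = -1) →
      (∀ u v : surfaceGen 3 → ℤ, symplForm (F u) (F v) = ε * symplForm u v) →
      (Submodule.span ℤ ((fun y => (Pi.single y (1 : ℤ) : surfaceGen 3 → ℤ)) '' s4CutSystem 0 0)).map F.toLinearMap =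
        Submodule.span ℤ ((fun y => (Pi.single y (1 : ℤ) : surfaceGen 3 → ℤ)) '' s4CutSystem 0 0) →
      (Submodule.span ℤ ((fun y => (Pi.single y (1 : ℤ) : surfaceGen 3 → ℤ)) '' s4CutSystem 0 1)).map F.toLinearMap =
        Submodule.span ℤ ((fun y => (Pi.single y (1 : ℤ) : surfaceGen 3 → ℤ)) '' s4CutSystem 0 1) →
      ∃ x : SurfaceGroup 3 ≃* SurfaceGroup 3, (s4Kernels 0).map x.toMonoidHom = s4Kernels 0 ∧
        (s4Kernels 1).map x.toMonoidHom = s4Kernels 1 ∧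
        ∀ s : SurfaceGroup 3, toAdd (SurfaceGroup.abelianize 3 (x s)) = F (toAdd (SurfaceGroup.abelianize 3 s)))
    {n : ℕ} (U : Fin n → SurfaceGroup 3 ≃* SurfaceGroup 3)
    (hU0 : ∀ k, (s4Kernels 0).map (U k).toMonoidHom = s4Kernels 0)
    (hU1 : ∀ k, (s4Kernels 1).map (U k).toMonoidHom = s4Kernels 1)
    (hUJ : ∀ k, ∀ s, U k s * s⁻¹ ∈ (⊤ : Subgroup (SurfaceGroup 3)).lowerCentralSeries (c + 1))
    (hL : ∀ D : Fin 3 → FreeLieAlgebra ℤ (Fin 3),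
      (∀ j, D j ∈ wordGrade ℤ (FreeLieAlgebra.of ℤ : Fin 3 → FreeLieAlgebra ℤ (Fin 3)) (c + 2)) →
      ⁅FreeLieAlgebra.of ℤ (0 : Fin 3), D 0⁆ + ⁅D 1, FreeLieAlgebra.of ℤ (1 : Fin 3)⁆ +
        ⁅D 2, FreeLieAlgebra.of ℤ (2 : Fin 3)⁆ = 0 →
      ∃ e : Fin n → ℤ, ∀ j : Fin 3,
        (∑ k, e k • θ (c + 1) (π (U k (PresentedGroup.of (j, (![true, false, false] : Fin 3 → Bool) j)) *
          (PresentedGroup.of (j, (![true, false, false] : Fin 3 → Bool) j) : SurfaceGroup 3)⁻¹))) + D j = 0)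
    (K2 : Subgroup (SurfaceGroup 3)) (α : SurfaceGroup 3 ≃* SurfaceGroup 3)
    (hα0 : (s4Kernels 0).map α.toMonoidHom = s4Kernels 0) (hα2 : (s4Kernels 2).map α.toMonoidHom = K2)
    (hK2 : K2 ⊔ (⊤ : Subgroup (SurfaceGroup 3)).lowerCentralSeries (c + 1) =
      s4Kernels 2 ⊔ (⊤ : Subgroup (SurfaceGroup 3)).lowerCentralSeries (c + 1)) :
    ∃ y : SurfaceGroup 3 ≃* SurfaceGroup 3, (s4Kernels 0).map y.toMonoidHom = s4Kernels 0 ∧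
      (s4Kernels 1).map y.toMonoidHom = s4Kernels 1 ∧
      (s4Kernels 2 ⊔ (⊤ : Subgroup (SurfaceGroup 3)).lowerCentralSeries (c + 2)).map y.toMonoidHom =
        K2 ⊔ (⊤ : Subgroup (SurfaceGroup 3)).lowerCentralSeries (c + 2) := by
  -- the cut system of `N₂`, its normal form, no hidden depth of `N₂ = ker π`
  have hN2 : (s4Kernels 2 : Subgroup (SurfaceGroup 3)) = normalClosure (PresentedGroup.of '' s4CutSystem 0 2) :=
    stub_cutNormalForm 0 2
  obtain ⟨ct, -, hct, -, -, -⟩ := helper_glueErasePi 0 2 (stub_cutNormalForm 0 2)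
  obtain ⟨c0, c1, c2⟩ := ct_values hct
  obtain rfl : ct = (![true, false, false] : Fin 3 → Bool) := funext fun i => by fin_cases i <;> simp [c0, c1, c2]
  have hπker' : π.ker = s4Kernels 2 := hπker
  have hπnhd : π.ker ⊓ (⊤ : Subgroup (SurfaceGroup 3)).lowerCentralSeries 1 ≤ ⁅π.ker, (⊤ : Subgroup (SurfaceGroup 3))⁆ :=
    stub_noHiddenDepth 3 3 π.ker (isFreeOfRank_quotient_ker π hπs)
  -- pair normalisation: an IA `α'` with `α'(N₂) = K₂`; the honest projection `ρ = π ∘ α'⁻¹` with kernel `K₂`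
  have hK2' : K2 ⊔ (⊤ : Subgroup (SurfaceGroup 3)).lowerCentralSeries 1 =
      s4Kernels 2 ⊔ (⊤ : Subgroup (SurfaceGroup 3)).lowerCentralSeries 1 := by
    have e : ∀ P : Subgroup (SurfaceGroup 3), P ⊔ (⊤ : Subgroup (SurfaceGroup 3)).lowerCentralSeries 1 =
        (P ⊔ (⊤ : Subgroup (SurfaceGroup 3)).lowerCentralSeries (c + 1)) ⊔
          (⊤ : Subgroup (SurfaceGroup 3)).lowerCentralSeries 1 :=
      fun P => by rw [sup_assoc, sup_eq_right.2 (lcs_antitone (show 1 ≤ c + 1 by omega))]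
    rw [e K2, hK2, ← e]
  obtain ⟨α', hα', hα'2⟩ := exists_ia_of_pair hA hR hα0 hα2 hK2'
  set ρ : SurfaceGroup 3 →* FreeGroup (Fin 3) := π.comp α'.symm.toMonoidHom with hρ
  have hρs : Function.Surjective ρ := hπs.comp α'.symm.surjective
  have hρker : ρ.ker = K2 := by rw [hρ, ker_comp_symm hπker' α', hα'2]
  haveI hK2n : K2.Normal := by rw [← hρker]; infer_instance
  have hρπ : ∀ s, π s = ρ (α' s) := fun s => by simp [hρ]
  -- the cut letters `X j`, their mates, the honest datum `d j = θ_{c+1}(ρ X_j)`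
  set X : Fin 3 → SurfaceGroup 3 := fun j => PresentedGroup.of (j, (![true, false, false] : Fin 3 → Bool) j) with hX
  have hXN : ∀ j, X j ∈ s4Kernels 2 := fun j => by
    rw [← hπker', MonoidHom.mem_ker, hX]; exact pi_cut π hπof j
  have hw : ∀ j, ρ (X j) ∈ (⊤ : Subgroup (FreeGroup (Fin 3))).lowerCentralSeries (c + 1) := fun j => by
    have h1 : X j ∈ K2 ⊔ (⊤ : Subgroup (SurfaceGroup 3)).lowerCentralSeries (c + 1) := by
      rw [hK2]; exact mem_sup_left (hXN j)
    obtain ⟨k, hk, g, hg, hkg⟩ := Subgroup.mem_sup_of_normal_right.1 h1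
    rw [← hkg, map_mul, (MonoidHom.mem_ker.1 (hρker ▸ hk : k ∈ ρ.ker)), one_mul]
    exact FreeGroupGrLie.map_mem_lcs ρ hg
  set d : Fin 3 → FreeLieAlgebra ℤ (Fin 3) := fun j => θ (c + 1) (ρ (X j)) with hd
  have hdL : ∀ j, d j ∈ wordGrade ℤ (FreeLieAlgebra.of ℤ : Fin 3 → FreeLieAlgebra ℤ (Fin 3)) (c + 2) := fun j => by
    have h1 : θ (c + 1) (ρ (X j)) ∈ θ (c + 1) '' ((⊤ : Subgroup (FreeGroup (Fin 3))).lowerCentralSeries (c + 1) : Set _) :=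
      ⟨_, hw j, rfl⟩
    rw [himg (c + 1)] at h1
    exact h1
  -- the honest constraint from the relator in the free group `S₃ ⧸ K₂`
  have hθ0M : ∀ j : Fin 3, θ 0 (ρ (PresentedGroup.of (j, !(![true, false, false] : Fin 3 → Bool) j))) =
      FreeLieAlgebra.of ℤ j := fun j => by
    rw [hρ, MonoidHom.comp_apply, MulEquiv.coe_toMonoidHom, theta0_pi θ hadd hof π hπof]
    have h1 : toAdd (SurfaceGroup.abelianize 3 (α'.symm (PresentedGroup.of (j, !(![true, false, false] : Fin 3 → Bool) j)))) =
        toAdd (SurfaceGroup.abelianize 3 (PresentedGroup.of (j, !(![true, false, false] : Fin 3 → Bool) j) : SurfaceGroup 3)) := by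
      have h2 := ia_symm hα' (PresentedGroup.of (j, !(![true, false, false] : Fin 3 → Bool) j))
      rw [← SurfaceGroup.ker_abelianize_eq_lowerCentralSeries, MonoidHom.mem_ker, map_mul, map_inv,
        mul_inv_eq_one] at h2
      rw [h2]
    rw [h1, SurfaceGroup.abelianize_of, toAdd_ofAdd, reduced_mate]
  have hC : ⁅FreeLieAlgebra.of ℤ (0 : Fin 3), d 0⁆ + ⁅d 1, FreeLieAlgebra.of ℤ (1 : Fin 3)⁆ +
      ⁅d 2, FreeLieAlgebra.of ℤ (2 : Fin 3)⁆ = 0 := by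
    have hrel := congrArg ρ relator_three
    rw [map_one, map_mul, map_mul, map_commutatorElement, map_commutatorElement, map_commutatorElement] at hrel
    have hw0 : ρ (PresentedGroup.of ((0 : Fin 3), true)) ∈ (⊤ : Subgroup (FreeGroup (Fin 3))).lowerCentralSeries (c + 1) := hw 0
    have hw1 : ρ (PresentedGroup.of ((1 : Fin 3), false)) ∈ (⊤ : Subgroup (FreeGroup (Fin 3))).lowerCentralSeries (c + 1) := hw 1
    have hw2 : ρ (PresentedGroup.of ((2 : Fin 3), false)) ∈ (⊤ : Subgroup (FreeGroup (Fin 3))).lowerCentralSeries (c + 1) := hw 2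
    have m0 : ⁅ρ (PresentedGroup.of ((0 : Fin 3), false)), ρ (PresentedGroup.of ((0 : Fin 3), true))⁆ ∈
        (⊤ : Subgroup (FreeGroup (Fin 3))).lowerCentralSeries (c + 2) :=
      Literature.GroupTheory.CombinatorialGroupTheory.commutator_mem_lcs_succ' _ hw0
    have m1 : ⁅ρ (PresentedGroup.of ((1 : Fin 3), false)), ρ (PresentedGroup.of ((1 : Fin 3), true))⁆ ∈
        (⊤ : Subgroup (FreeGroup (Fin 3))).lowerCentralSeries (c + 2) :=
      Literature.GroupTheory.CombinatorialGroupTheory.commutator_mem_lcs_succ hw1 _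
    have m2 : ⁅ρ (PresentedGroup.of ((2 : Fin 3), false)), ρ (PresentedGroup.of ((2 : Fin 3), true))⁆ ∈
        (⊤ : Subgroup (FreeGroup (Fin 3))).lowerCentralSeries (c + 2) :=
      Literature.GroupTheory.CombinatorialGroupTheory.commutator_mem_lcs_succ hw2 _
    have e0 := hbr 0 (c + 1) _ (mem_top (ρ (PresentedGroup.of ((0 : Fin 3), false)))) _ hw0
    have e1 := hbr (c + 1) 0 _ hw1 _ (mem_top (ρ (PresentedGroup.of ((1 : Fin 3), true))))
    have e2 := hbr (c + 1) 0 _ hw2 _ (mem_top (ρ (PresentedGroup.of ((2 : Fin 3), true))))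
    rw [show (0 + (c + 1) + 1 : ℕ) = c + 2 by omega] at e0
    rw [show (c + 1 + 0 + 1 : ℕ) = c + 2 by omega] at e1 e2
    have hsum := congrArg (θ (c + 2)) hrel
    have f0 : θ 0 (ρ (PresentedGroup.of ((0 : Fin 3), false))) = FreeLieAlgebra.of ℤ 0 := hθ0M 0
    have f1 : θ 0 (ρ (PresentedGroup.of ((1 : Fin 3), true))) = FreeLieAlgebra.of ℤ 1 := hθ0M 1
    have f2 : θ 0 (ρ (PresentedGroup.of ((2 : Fin 3), true))) = FreeLieAlgebra.of ℤ 2 := hθ0M 2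
    rw [theta_one θ hadd, hadd (c + 2) _ (mul_mem m0 m1) _ m2, hadd (c + 2) _ m0 _ m1, e0, e1, e2, f0, f1, f2] at hsum
    exact hsum
  -- realisation: integers `e` from the Lie side, the Goeritz element `y = ∏ U_k ^ e_k`
  obtain ⟨e, he⟩ := hL d hdL hC
  set y : SurfaceGroup 3 ≃* SurfaceGroup 3 :=
    ((List.finRange n).map fun k => ((U k : MulAut (SurfaceGroup 3)) ^ e k : MulAut (SurfaceGroup 3))).prod with hy
  have hyU := fun s => datum_list_prod_zpow_level θ hadd hker π (c + 1) (by omega) (List.finRange n) U e hUJ s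
  have hyc : ∀ s, y s * s⁻¹ ∈ (⊤ : Subgroup (SurfaceGroup 3)).lowerCentralSeries (c + 1) := (hyU 1).1
  have hydat : ∀ j, θ (c + 1) (π (y (X j) * (X j)⁻¹)) = -d j := fun j => by
    rw [hy, (hyU (X j)).2, ← Fin.sum_univ_def, eq_neg_iff_add_eq_zero]
    exact he j
  have hy0 : (s4Kernels 0).map y.toMonoidHom = s4Kernels 0 :=
    map_list_prod_eq _ _ _ fun k => map_zpow_eq_of_map_eq _ (hU0 k) _
  have hy1 : (s4Kernels 1).map y.toMonoidHom = s4Kernels 1 :=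
    map_list_prod_eq _ _ _ fun k => map_zpow_eq_of_map_eq _ (hU1 k) _
  -- lifts `u` of the honest datum: `u ∈ γ_{c+2}`, `ρ u = (ρ X_j)⁻¹`
  have hex : ∀ s : SurfaceGroup 3, ∃ v : SurfaceGroup 3,
      (ρ s ∈ (⊤ : Subgroup (FreeGroup (Fin 3))).lowerCentralSeries (c + 1) →
        v ∈ (⊤ : Subgroup (SurfaceGroup 3)).lowerCentralSeries (c + 1) ∧ ρ v = (ρ s)⁻¹) := fun s => by
    by_cases hs : ρ s ∈ (⊤ : Subgroup (FreeGroup (Fin 3))).lowerCentralSeries (c + 1)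
    · have h1 : (ρ s)⁻¹ ∈ ((⊤ : Subgroup (SurfaceGroup 3)).lowerCentralSeries (c + 1)).map ρ := by
        rw [map_lcs_eq_of_surjective ρ hρs (c + 1)]; exact inv_mem hs
      obtain ⟨v, hv, hve⟩ := h1
      exact ⟨v, fun _ => ⟨hv, hve⟩⟩
    · exact ⟨1, fun h => absurd h hs⟩
  choose u hu using hex
  -- the layer step from realised data, at level `c`
  have key := helper_layerOfData 3 c (PresentedGroup.of '' s4CutSystem 0 2) K2
    (stub_noHiddenDepth 3 3 K2 ((isFreeOfRank_quotient_ker ρ hρs).of_mulEquiv (QuotientGroup.quotientMulEquivOfEq hρker)))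
    (by rw [← hN2]; exact hK2) y hyc u ?_ ?_ ?_
  · rw [← hN2] at key
    exact ⟨y, hy0, hy1, key⟩
  · rintro _ ⟨⟨j, b⟩, hjb, rfl⟩
    obtain rfl : b = (![true, false, false] : Fin 3 → Bool) j := (hct j b).1 hjb
    exact ((hu (X j)) (hw j)).1
  · rintro _ ⟨⟨j, b⟩, hjb, rfl⟩
    obtain rfl : b = (![true, false, false] : Fin 3 → Bool) j := (hct j b).1 hjb
    rw [← hρker, MonoidHom.mem_ker, map_mul, ((hu (X j)) (hw j)).2, inv_mul_cancel]
  · rintro _ ⟨⟨j, b⟩, hjb, rfl⟩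
    obtain rfl : b = (![true, false, false] : Fin 3 → Bool) j := (hct j b).1 hjb
    obtain ⟨huc, hue⟩ := (hu (X j)) (hw j)
    rw [← hN2, ← hπker']
    have hsc : y (X j) * (X j)⁻¹ * (u (X j))⁻¹ ∈ (⊤ : Subgroup (SurfaceGroup 3)).lowerCentralSeries (c + 1) :=
      mul_mem (hyc _) (inv_mem huc)
    refine mem_commutator_sup_of_map_mem_level π hπs hπnhd c hsc ?_
    rw [← (hker (c + 1) _ (FreeGroupGrLie.map_mem_lcs π hsc)), map_mul,
      hadd (c + 1) _ (FreeGroupGrLie.map_mem_lcs π (hyc _)) _ (FreeGroupGrLie.map_mem_lcs π (inv_mem huc)), hydat j,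
      map_inv, theta_inv θ hadd (c + 1) (FreeGroupGrLie.map_mem_lcs π huc)]
    -- `θ_{c+1}(π u) = θ_{c+1}(ρ u) = -d j` since `α'` acts trivially on `γ_{c+2}/γ_{c+3}`
    have hπu : θ (c + 1) (π (u (X j))) = -d j := by
      have h3 : α' (u (X j)) * (u (X j))⁻¹ ∈ (⊤ : Subgroup (SurfaceGroup 3)).lowerCentralSeries (c + 1 + 1) := by
        have h4 := jk_lcs α'.toMonoidHom hα' (c + 1) _ huc
        rwa [show (1 + (c + 1) : ℕ) = c + 1 + 1 by omega] at h4
      rw [hρπ, show α' (u (X j)) = (α' (u (X j)) * (u (X j))⁻¹) * u (X j) by rw [inv_mul_cancel_right], map_mul,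
        theta_mul_of_mem_succ θ hadd hker (c + 1) (FreeGroupGrLie.map_mem_lcs ρ h3) (FreeGroupGrLie.map_mem_lcs ρ huc),
        hue, theta_inv θ hadd (c + 1) (hw j)]
    rw [hπu, neg_neg, neg_add_cancel]

end Symbols

end LayerZeroThree

/-- **Registered helper `helper_layerZeroThreeCore`** (sub-goal of stub `stub_layerStepZeroThree`, item
stmt-SmoothPoincare4-14595): the layer step `(0,3)` at genus `3` from a Lie-realising family, in closed form — for the
Magnus–Witt symbols `θ` of `F₃` and the erasing projection `π` of `N₂` (variables with their characterising hypotheses),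
ANY finite family `U₁, …, Uₙ ∈ Stab N₀ ∩ Stab N₁ ∩ 𝒥₄` whose degree-five data `θ₄(π(U_k(X_j)X_j⁻¹))` at the cut letters
`X_j = b₀, a₁, a₂` realise the negative of every relator-constrained datum of `L₅(ℤ³)³`, (AUTSYMP) at genus `3` and (REAL)
for the pair `(0,1)` give: every `K₂ = α(N₂)`, `α ∈ Stab N₀`, with `K₂ γ₅ = N₂ γ₅` is reached modulo `γ₆` by some
`y ∈ Stab N₀ ∩ Stab N₁` (`layerStep_core_of_family` at `c = 3`). [folklore] -/
theorem helper_layerZeroThreeCore : (∀ (φ : SurfaceGroup 3 ≃* SurfaceGroup 3), ∃ (F : (surfaceGen 3 → ℤ) ≃ₗ[ℤ] (surfaceGen 3 → ℤ)) (ε : ℤ), (ε = 1 ∨ ε = -1) ∧ (∀ s : SurfaceGroup 3, toAdd (SurfaceGroup.abelianize 3 (φ s)) = F (toAdd (SurfaceGroup.abelianize 3 s))) ∧ ∀ u v : surfaceGen 3 → ℤ, symplForm (F u) (F v) = ε * symplForm u v) → (∀ (F : (surfaceGen 3 → ℤ) ≃ₗ[ℤ] (surfaceGen 3 → ℤ))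 (ε : ℤ), (ε = 1 ∨ ε = -1) → (∀ u v : surfaceGen 3 → ℤ, symplForm (F u) (F v) = ε * symplForm u v) → (Submodule.span ℤ ((fun y => (Pi.single y (1 : ℤ) : surfaceGen 3 → ℤ)) '' s4CutSystem 0 0)).map F.toLinearMap = Submodule.span ℤ ((fun y => (Pi.single y (1 : ℤ) : surfaceGen 3 → ℤ)) '' s4CutSystem 0 0) → (Submodule.span ℤ ((fun y => (Pi.single y (1 : ℤ) : surfaceGen 3 → ℤ)) '' s4CutSystem 0 1)).map F.toLinearMap = Submodule.span ℤ ((fun y => (Pi.single y (1 : ℤ) : surfaceGen 3 → ℤ)) '' s4CutSystem 0 1) → ∃ x : SurfaceGroup 3 ≃* SurfaceGroup 3, (s4Kernels 0).map x.toMonoidHom = s4Kernels 0 ∧ (s4Kernels 1).map x.toMonoidHom = s4Kernels 1 ∧ ∀ s : SurfaceGroup 3, toAdd (SurfaceGroup.abelianize 3 (x s)) = F (toAdd (SurfaceGroup.abelianize 3 s))) → ∀ (θ : ℕ → FreeGroup (Fin 3) → FreeLieAlgebra ℤ (Fin 3)), (∀ k, ∀ x ∈ (⊤ : Subgroup (FreeGroup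 (Fin 3))).lowerCentralSeries k, ∀ y ∈ (⊤ : Subgroup (FreeGroup (Fin 3))).lowerCentralSeries k, θ k (x * y) = θ k x + θ k y) → (∀ k, θ k '' ((⊤ : Subgroup (FreeGroup (Fin 3))).lowerCentralSeries k) = wordGrade ℤ (FreeLieAlgebra.of ℤ : Fin 3 → FreeLieAlgebra ℤ (Fin 3)) (k + 1)) → (∀ k, ∀ x ∈ (⊤ : Subgroup (FreeGroup (Fin 3))).lowerCentralSeries k, θ k x = 0 ↔ x ∈ (⊤ : Subgroup (FreeGroup (Fin 3))).lowerCentralSeries (k + 1)) → (∀ i : Fin 3, θ 0 (FreeGroup.of i) = FreeLieAlgebra.of ℤ i) → (∀ j k, ∀ x ∈ (⊤ : Subgroup (FreeGroup (Fin 3))).lowerCentralSeries j, ∀ y ∈ (⊤ : Subgroup (FreeGroup (Fin 3))).lowerCentralSeries k, θ (j + k + 1) ⁅x, y⁆ = ⁅θ j x, θ k y⁆) → ∀ (π : SurfaceGroup 3 →* FreeGroup (Fin 3)), Function.Surjective π → π.ker = s4Kernels 2 → (∀ (h : Fin 3) (b : Bool), π (PresentedGroup.of (h, b)) = if b = (![true,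 false, false] : Fin 3 → Bool) h then 1 else FreeGroup.of h) → ∀ (n : ℕ) (U : Fin n → SurfaceGroup 3 ≃* SurfaceGroup 3), (∀ k, (s4Kernels 0).map (U k).toMonoidHom = s4Kernels 0) → (∀ k, (s4Kernels 1).map (U k).toMonoidHom = s4Kernels 1) → (∀ k, ∀ s : SurfaceGroup 3, U k s * s⁻¹ ∈ (⊤ : Subgroup (SurfaceGroup 3)).lowerCentralSeries 4) → (∀ D : Fin 3 → FreeLieAlgebra ℤ (Fin 3), (∀ j, D j ∈ wordGrade ℤ (FreeLieAlgebra.of ℤ : Fin 3 → FreeLieAlgebra ℤ (Fin 3)) 5) → ⁅FreeLieAlgebra.of ℤ (0 : Fin 3), D 0⁆ + ⁅D 1, FreeLieAlgebra.of ℤ (1 : Fin 3)⁆ + ⁅D 2, FreeLieAlgebra.of ℤ (2 : Fin 3)⁆ = 0 → ∃ e : Fin n → ℤ, ∀ j : Fin 3, (∑ k, e k • θ 4 (π (U k (PresentedGroup.of (j, (![true, false, false] : Fin 3 → Bool) j)) * (PresentedGroup.of (j, (![true, false, false] : Fin 3 → Bool) j) : SurfaceGroup 3)⁻¹))) + D j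 = 0) → ∀ (K₂ : Subgroup (SurfaceGroup 3)) (α : SurfaceGroup 3 ≃* SurfaceGroup 3), (s4Kernels 0).map α.toMonoidHom = s4Kernels 0 → (s4Kernels 2).map α.toMonoidHom = K₂ → K₂ ⊔ (⊤ : Subgroup (SurfaceGroup 3)).lowerCentralSeries 4 = s4Kernels 2 ⊔ (⊤ : Subgroup (SurfaceGroup 3)).lowerCentralSeries 4 → ∃ y : SurfaceGroup 3 ≃* SurfaceGroup 3, (s4Kernels 0).map y.toMonoidHom = s4Kernels 0 ∧ (s4Kernels 1).map y.toMonoidHom = s4Kernels 1 ∧ (s4Kernels 2 ⊔ (⊤ : Subgroup (SurfaceGroup 3)).lowerCentralSeries 5).map y.toMonoidHom = K₂ ⊔ (⊤ : Subgroup (SurfaceGroup 3)).lowerCentralSeries 5 :=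
  fun hA hR θ hadd himg hker hof hbr π hπs hπker hπof _ U hU0 hU1 hUJ hL K₂ α hα0 hα2 hK2 =>
    LayerZeroThree.layerStep_core_of_family θ hadd himg hker hof hbr π hπs hπker hπof 3 hA hR U hU0 hU1 hUJ hL K₂ α
      hα0 hα2 hK2

end Summit.SmoothPoincare4.SmoothPoincare4.Theorems.ShadowApproximation.NilpotentGenusClass

end
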